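import Literature.NumberTheory.ComplexMultiplication.CMAlgebraLatticeLocallyPrincipal
import HarnessLib

/-!
# `G([Λ_2]_ε) → G([Λ_1]_ε)`, `[L]_ε ↦ [Λ_1L]_ε`, is SURJECTIVE for orders `Λ_2 ⊆ Λ_1` of a CM-ALGEBRA
# `Y = L_1 ⊕ ⋯ ⊕ L_t`, all its fibres have the size of its kernel, and
# `#G([Λ_2]_ε) = #G([Λ_1]_ε) · #ker` (Hertling–Larabi 2026 Thm. 8.2 (b), (e), (f))

[node N13c] [stratum S1] [book HertlingLarabi2026 > §8 Exact sequences for an order and a smaller order > Lemma 8.1 (b), Thm. 8.2 (b), (e), (f)]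

Topic `Literature/NumberTheory/ComplexMultiplication`, namespace `Literature.NumberTheory.ComplexMultiplication`;
lane `lit-hodgefound` (Track 2 foundations library), Layer A3, seat p19 generation 32, row g32-#6 — sequel of
g32-#4 (`CMAlgebraLatticeLocallyPrincipal`: Thm. 8.2 (b) Step 1, `exists_invertible_order_mul_eq`: for
`L_1 ∈ G(Λ_1)` there is `L_2 ∈ G(Λ_2)` with `Λ_1L_2 = L_1`), g32-#3 (`CMAlgebraLatticeLocalUnits`: Lemma 8.1 (b),
`div_self_order_mul_eq_of_le`, `units_smul_order_mul`) and g32-#1 (`CMAlgebraLatticeWeakEquivalence`: the finite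
sets `Pic(R) = G([R]_ε)` as `Quot`s, `finite_quot_pic_div_self_eq`).  THEOREMS ONLY: no definition, no instance,
no named fact (D-0026, net Literature debt `0`), no `sorry`.

VOCABULARY (g32-#1).  For an order `R`, `G(R)` is the subtype of full lattices `M` with `M/M = R` and
`M·((M/M)/M) = M/M`, and `G([R]_ε) = Pic(R)` is its `Quot` by `M ∼ M' :⟺ ∃ u ∈ Y^{unit}, uM = M'`; all statements
below spell these out.

## Source, VERBATIM

C. Hertling, K. Larabi, *Semigroups from full lattices in commutative ℚ-algebras*, arXiv:2602.14973 (2026)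
[HertlingLarabi2026], held `paper:arxiv-2602.14973`.  §8 (chunks p0021–p0023): «**Lemma 8.1.** […] (b) Let `Λ_1`
and `Λ_2 ∈ 𝓛(A)` be two orders with `Λ_2 ⊊ Λ_1`. If `L ∈ G(Λ_2)` then `Λ_1L ∈ G(Λ_1)`. This leads to group
homomorphisms `G(Λ_2) → G(Λ_1), L ↦ Λ_1L` (8.1), `G([Λ_2]_ε) → G([Λ_1]_ε), [L]_ε ↦ [Λ_1L]_ε` (8.2). […]
**Theorem 8.2.** […] (b) The following sequence is exact, `1 → ∏(Λ_2)_(p)^{unit} → ∏(Λ_1)_(p)^{unit} → G(Λ_2) →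
G(Λ_1) → 1`. Especially, the group homomorphism in (8.1) is surjective. […] (e) The maps in the following
sequence are the natural ones, the sequence is exact,
`1 → Λ_2^{unit} → Λ_1^{unit} → ∏_{p∈P_0}(Λ_1)_(p)^{unit}/(Λ_2)_(p)^{unit} → G([Λ_2]_ε) → G([Λ_1]_ε) → 1`.
Especially, the group homomorphism in (8.2) is surjective. (f) […] By Theorem 6.5 the groups `G([Λ_2]_ε)` and
`G([Λ_1]_ε)` are finite. The size of one of them can be calculated by the size of the other one with the
following formula, `|G([Λ_2]_ε)|/|G([Λ_1]_ε)| = |(Λ_1/C)^{unit}|/|(Λ_2/C)^{unit}| · 1/[Λ_1^{unit} : Λ_2^{unit}]`.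
[…] *Proof of the Claim* [(e)]: Consider `L̃ ∈ G(Λ_2)` with `[L̃]_ε ∈ ker(G([Λ_2]_ε) → G([Λ_1]_ε))`. Then
`[Λ_1L̃]_ε = [Λ_1]_ε`, so an element `a ∈ A^{unit}` with `Λ_1L̃ = aΛ_1` exists. […]»  «**Remarks 8.3.** […] Then the
Propositions (12.9) and (12.11) in [Ne99] are analogs of the parts (e) and (c) of Theorem 8.2. Theorem (12.12) in
[Ne99] is a special case of part (f) of Theorem 8.2. The surjectivity of the map in (8.1) for the case when `A`
is an algebraic number field is also proved in [DTZ62].»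

## Contents (what is proved, and what is not)

* §1 (8.2) is well defined and SURJECTIVE on `ε`-classes: `quot_pic_order_mul_surjective` (from g32-#4's lattice
  level surjectivity), with the membership `order_mul_mem_pic` (Lemma 8.1 (b)).
* §2 `natCard_quot_pic_le`: `#G([Λ_1]_ε) ≤ #G([Λ_2]_ε)` for orders `Λ_2 ⊆ Λ_1` (both finite, Thm. 6.5).
* §3 `natCard_fiber_quot_pic_eq`: every fibre of (8.2) is in bijection with the kernel
  `{[K]_ε ∈ G([Λ_2]_ε) | Λ_1K = uΛ_1 for a unit u}` (translate by `[L_2]_ε` with `Λ_1L_2 = L_1`, divide by `L_2⁻¹`),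
  and `natCard_quot_pic_eq_natCard_quot_pic_mul_natCard_ker`: **`#G([Λ_2]_ε) = #G([Λ_1]_ε) · #ker`** — the
  counting content of (e)–(f).  NOT formalised here: the identification of the kernel with
  `∏(Λ_1)_(p)^{unit}/(Λ_2)_(p)^{unit}` modulo `Λ_1^{unit}` ((e)) and with `(Λ_1/C)^{unit}/(Λ_2/C)^{unit}` ((c), (f)).

## References

* [HL26] C. Hertling, K. Larabi, *Semigroups from full lattices in commutative ℚ-algebras*, arXiv:2602.14973
  (2026), §8 Lemma 8.1 (b), Thm. 8.2 (b), (e), (f), Rem. 8.3 (chunks p0021–p0023). [cite: HertlingLarabi2026]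
* [DTZ62] E. C. Dade, O. Taussky, H. Zassenhaus, Math. Ann. 148 (1962) 31–64 (surjectivity of `G(Λ_2) → G(Λ_1)` for
  a number field, as cited by [HL26] Rem. 8.3). [cite: DadeTausskyZassenhaus1962]
* [Ne99] J. Neukirch, *Algebraic Number Theory*, Grundlehren 322 (1999), I §12 Prop. (12.9), Thm. (12.12) (one
  field: `Pic(𝒪) → Pic(𝒪_K)` surjective and `h(𝒪) = h_K · #(𝒪_K/𝔣)^*/#(𝒪/𝔣)^* / [𝒪_K^* : 𝒪^*]`), as identified in
  [HL26] Rem. 8.3. [cite: NeukirchANT1999]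
-/

noncomputable section

open scoped Classical Pointwise nonZeroDivisors NumberField
open Module NumberField Function

namespace Literature.NumberTheory.ComplexMultiplication

open Literature.NumberTheory.Automorphic

section PicardExtension

variable {t : Type} {L : t → Type} [∀ i, Field (L i)] [∀ i, NumberField (L i)] [Fintype t]

/-! ## §1 (8.2) on `ε`-classes: well defined and surjective -/

omit [Fintype t] in
/-- **LEMMA 8.1 (b): `Λ_1L ∈ G(Λ_1)` for `L ∈ G(Λ_2)`, orders `Λ_2 ⊆ Λ_1`** (g32-#3 `div_self_order_mul_eq_of_le` packaged
with fullness, in g32-#1's `G(R)`-subtype form). [cite: HertlingLarabi2026, §8 Lemma 8.1 (b) (8.1), chunk p0021] -/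
theorem order_mul_mem_pic {Λ₁ Λ₂ : Submodule ℤ (Π i, L i)} (hΛ₁ : IsFullLattice (Π i, L i) Λ₁)
    (h1 : (1 : Π i, L i) ∈ Λ₁) (hΛ₁Λ₁ : Λ₁ * Λ₁ ≤ Λ₁) (h2 : (1 : Π i, L i) ∈ Λ₂) (hle : Λ₂ ≤ Λ₁)
    (M : {M : Submodule ℤ (Π i, L i) //
      (IsFullLattice (Π i, L i) M ∧ M / M = Λ₂) ∧ M * ((M / M) / M) = M / M}) :
    (IsFullLattice (Π i, L i) (Λ₁ * M.1) ∧ (Λ₁ * M.1) / (Λ₁ * M.1) = Λ₁) ∧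
      (Λ₁ * M.1) * (((Λ₁ * M.1) / (Λ₁ * M.1)) / (Λ₁ * M.1)) = (Λ₁ * M.1) / (Λ₁ * M.1) :=
  have h := div_self_order_mul_eq_of_le hΛ₁ h1 hΛ₁Λ₁ h2 hle M.2.1.1 M.2.1.2 M.2.2
  ⟨⟨isFullLattice_mul hΛ₁ M.2.1.1, h.1⟩, h.2⟩

omit [Fintype t] in
/-- **THEOREM 8.2 (b)/(e): the map (8.2) `G([Λ_2]_ε) → G([Λ_1]_ε)`, `[L]_ε ↦ [Λ_1L]_ε`, is SURJECTIVE** for orders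
`Λ_2 ⊆ Λ_1` of `Y` — every class `[L_1]_ε ∈ G([Λ_1]_ε)` is `[Λ_1L_2]_ε` for some `L_2 ∈ G(Λ_2)` (indeed with
`Λ_1L_2 = L_1`, g32-#4). [cite: HertlingLarabi2026, §8 Thm. 8.2 (b), (e) («Especially, the group homomorphism in (8.2) is surjective»), chunks p0021, p0023]
[cite: DadeTausskyZassenhaus1962, as cited by HertlingLarabi2026 Rem. 8.3 (number-field case)] -/
theorem quot_pic_order_mul_surjective {Λ₁ Λ₂ : Submodule ℤ (Π i, L i)} (hΛ₁ : IsFullLattice (Π i, L i) Λ₁)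
    (h1 : (1 : Π i, L i) ∈ Λ₁) (hΛ₁Λ₁ : Λ₁ * Λ₁ ≤ Λ₁) (hΛ₂ : IsFullLattice (Π i, L i) Λ₂)
    (h2 : (1 : Π i, L i) ∈ Λ₂) (hΛ₂Λ₂ : Λ₂ * Λ₂ ≤ Λ₂) (hle : Λ₂ ≤ Λ₁)
    (q : Quot (fun M M' : {M : Submodule ℤ (Π i, L i) //
        (IsFullLattice (Π i, L i) M ∧ M / M = Λ₁) ∧ M * ((M / M) / M) = M / M} =>
      ∃ u : (Π i, L i)ˣ, u • (M : Submodule ℤ (Π i, L i)) = M')) :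
    ∃ M : {M : Submodule ℤ (Π i, L i) //
        (IsFullLattice (Π i, L i) M ∧ M / M = Λ₂) ∧ M * ((M / M) / M) = M / M},
      Quot.mk _ ⟨Λ₁ * M.1, order_mul_mem_pic hΛ₁ h1 hΛ₁Λ₁ h2 hle M⟩ = q := by
  induction q using Quot.ind with | mk L₁ => ?_
  obtain ⟨L₂, hL₂, hO₂, hinv₂, hmul⟩ :=
    exists_invertible_order_mul_eq hΛ₁Λ₁ hΛ₂ h2 hΛ₂Λ₂ hle L₁.2.1.1 L₁.2.1.2 L₁.2.2
  refine ⟨⟨L₂, ⟨hL₂, hO₂⟩, hinv₂⟩, ?_⟩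
  congr 1
  exact Subtype.ext hmul

/-! ## §2 `#G([Λ_1]_ε) ≤ #G([Λ_2]_ε)` -/

/-- **`#G([Λ_1]_ε) ≤ #G([Λ_2]_ε)` for orders `Λ_2 ⊆ Λ_1` of `Y`** — the Picard group of the bigger order is a quotient
of that of the smaller one ((8.2) is surjective; both are finite by Thm. 6.5 ∕ g32-#1 `finite_quot_pic_div_self_eq`).
[cite: HertlingLarabi2026, §8 Thm. 8.2 (e), (f) («the group homomorphism in (8.2) is surjective»; «the groups G([Λ_2]_ε) and G([Λ_1]_ε) are finite»), chunks p0021–p0023]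
[cite: NeukirchANT1999, I §12 Prop. (12.9) (one field: `Pic(𝒪) → Pic(𝒪_K) → 0`)] -/
theorem natCard_quot_pic_le {Λ₁ Λ₂ : Submodule ℤ (Π i, L i)} (hΛ₁ : IsFullLattice (Π i, L i) Λ₁)
    (h1 : (1 : Π i, L i) ∈ Λ₁) (hΛ₁Λ₁ : Λ₁ * Λ₁ ≤ Λ₁) (hΛ₂ : IsFullLattice (Π i, L i) Λ₂)
    (h2 : (1 : Π i, L i) ∈ Λ₂) (hΛ₂Λ₂ : Λ₂ * Λ₂ ≤ Λ₂) (hle : Λ₂ ≤ Λ₁) :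
    Nat.card (Quot (fun M M' : {M : Submodule ℤ (Π i, L i) //
        (IsFullLattice (Π i, L i) M ∧ M / M = Λ₁) ∧ M * ((M / M) / M) = M / M} =>
      ∃ u : (Π i, L i)ˣ, u • (M : Submodule ℤ (Π i, L i)) = M')) ≤
    Nat.card (Quot (fun M M' : {M : Submodule ℤ (Π i, L i) //
        (IsFullLattice (Π i, L i) M ∧ M / M = Λ₂) ∧ M * ((M / M) / M) = M / M} =>
      ∃ u : (Π i, L i)ˣ, u • (M : Submodule ℤ (Π i, L i)) = M')) := by
  classical
  haveI := finite_quot_pic_div_self_eq (L := L) Λ₂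
  let φ : Quot (fun M M' : {M : Submodule ℤ (Π i, L i) //
        (IsFullLattice (Π i, L i) M ∧ M / M = Λ₂) ∧ M * ((M / M) / M) = M / M} =>
      ∃ u : (Π i, L i)ˣ, u • (M : Submodule ℤ (Π i, L i)) = M') →
      Quot (fun M M' : {M : Submodule ℤ (Π i, L i) //
        (IsFullLattice (Π i, L i) M ∧ M / M = Λ₁) ∧ M * ((M / M) / M) = M / M} =>
      ∃ u : (Π i, L i)ˣ, u • (M : Submodule ℤ (Π i, L i)) = M') :=
    Quot.lift (fun M => Quot.mk _ ⟨Λ₁ * M.1, order_mul_mem_pic hΛ₁ h1 hΛ₁Λ₁ h2 hle M⟩)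
      fun M M' ⟨u, hu⟩ => Quot.sound ⟨u, by
        change u • (Λ₁ * M.1) = Λ₁ * M'.1
        rw [← units_smul_order_mul, hu]⟩
  refine Nat.card_le_card_of_surjective φ fun q => ?_
  obtain ⟨M, hM⟩ := quot_pic_order_mul_surjective hΛ₁ h1 hΛ₁Λ₁ hΛ₂ h2 hΛ₂Λ₂ hle q
  exact ⟨Quot.mk _ M, hM⟩

/-! ## §3 The fibres of (8.2) are translates of its kernel; `#G([Λ_2]_ε) = #G([Λ_1]_ε) · #ker` -/

omit [Fintype t] in
/-- `G(Λ)` is closed under products (Thm. 4.2 (c), g31-#9), in the `G(R)`-subtype form. [cite: HertlingLarabi2026, §4 Thm. 4.2 (c), (d), chunk p0009] -/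
theorem mul_mem_pic {Λ : Submodule ℤ (Π i, L i)}
    (K M : {M : Submodule ℤ (Π i, L i) //
      (IsFullLattice (Π i, L i) M ∧ M / M = Λ) ∧ M * ((M / M) / M) = M / M}) :
    (IsFullLattice (Π i, L i) (K.1 * M.1) ∧ (K.1 * M.1) / (K.1 * M.1) = Λ) ∧
      (K.1 * M.1) * (((K.1 * M.1) / (K.1 * M.1)) / (K.1 * M.1)) = (K.1 * M.1) / (K.1 * M.1) :=
  ⟨⟨isFullLattice_mul K.2.1.1 M.2.1.1,
    div_self_mul_eq_of_mul_div_eq_of_div_self_eq K.2.1.1 M.2.1.1 K.2.2 M.2.2 K.2.1.2 M.2.1.2⟩,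
    mul_invertible_of_mul_div_eq K.2.1.1 M.2.1.1 K.2.2 M.2.2⟩

omit [Fintype t] in
/-- `G(Λ)` is closed under inverses `L⁻¹ = (L:L):L` (Thm. 5.6 (c), g31-#5), in the `G(R)`-subtype form.
[cite: HertlingLarabi2026, §5 Thm. 5.6 (c) («L⁻¹ is invertible with 𝒪(L⁻¹) = 𝒪(L)»), chunk p0012] -/
theorem inv_mem_pic {Λ : Submodule ℤ (Π i, L i)}
    (M : {M : Submodule ℤ (Π i, L i) //
      (IsFullLattice (Π i, L i) M ∧ M / M = Λ) ∧ M * ((M / M) / M) = M / M}) :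
    (IsFullLattice (Π i, L i) ((M.1 / M.1) / M.1) ∧ ((M.1 / M.1) / M.1) / ((M.1 / M.1) / M.1) = Λ) ∧
      ((M.1 / M.1) / M.1) * ((((M.1 / M.1) / M.1) / ((M.1 / M.1) / M.1)) / ((M.1 / M.1) / M.1)) =
        ((M.1 / M.1) / M.1) / ((M.1 / M.1) / M.1) := by
  have hO : ((M.1 / M.1) / M.1) / ((M.1 / M.1) / M.1) = M.1 / M.1 := div_div_self_of_mul_div_eq M.2.2
  refine ⟨⟨isFullLattice_div (isFullLattice_div M.2.1.1 M.2.1.1) M.2.1.1, by rw [hO]; exact M.2.1.2⟩, ?_⟩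
  rw [hO]
  exact (inv_mul_div_eq_of_mul_div_eq M.2.2).2

omit [Fintype t] in
/-- **THEOREM 8.2 (e), counting form: every FIBRE of (8.2) `G([Λ_2]_ε) → G([Λ_1]_ε)` is in bijection with its
KERNEL** `{[K]_ε | uΛ_1K = Λ_1 for some u ∈ Y^{unit}}` — for `L_1 ∈ G(Λ_1)` pick `L_2 ∈ G(Λ_2)` with `Λ_1L_2 = L_1`
(Thm. 8.2 (b) Step 1); `[K]_ε ↦ [KL_2]_ε` is a bijection from the kernel onto the fibre over `[L_1]_ε` (inverse
`[M]_ε ↦ [ML_2⁻¹]_ε`). [cite: HertlingLarabi2026, §8 Thm. 8.2 (e) (exactness at G([Λ_2]_ε) and surjectivity; proof of the Claim), chunks p0021–p0023] -/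
theorem natCard_fiber_quot_pic_eq {Λ₁ Λ₂ : Submodule ℤ (Π i, L i)}
    (hΛ₁Λ₁ : Λ₁ * Λ₁ ≤ Λ₁) (hΛ₂ : IsFullLattice (Π i, L i) Λ₂)
    (h2 : (1 : Π i, L i) ∈ Λ₂) (hΛ₂Λ₂ : Λ₂ * Λ₂ ≤ Λ₂) (hle : Λ₂ ≤ Λ₁)
    (L₁ : {M : Submodule ℤ (Π i, L i) //
      (IsFullLattice (Π i, L i) M ∧ M / M = Λ₁) ∧ M * ((M / M) / M) = M / M}) :
    Nat.card {q : Quot (fun M M' : {M : Submodule ℤ (Π i, L i) //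
          (IsFullLattice (Π i, L i) M ∧ M / M = Λ₂) ∧ M * ((M / M) / M) = M / M} =>
        ∃ u : (Π i, L i)ˣ, u • (M : Submodule ℤ (Π i, L i)) = M') //
      ∃ M : {M : Submodule ℤ (Π i, L i) //
          (IsFullLattice (Π i, L i) M ∧ M / M = Λ₂) ∧ M * ((M / M) / M) = M / M},
        Quot.mk _ M = q ∧ ∃ u : (Π i, L i)ˣ, u • (Λ₁ * M.1) = L₁.1} =
    Nat.card {q : Quot (fun M M' : {M : Submodule ℤ (Π i, L i) //
          (IsFullLattice (Π i, L i) M ∧ M / M = Λ₂) ∧ M * ((M / M) / M) = M / M} =>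
        ∃ u : (Π i, L i)ˣ, u • (M : Submodule ℤ (Π i, L i)) = M') //
      ∃ M : {M : Submodule ℤ (Π i, L i) //
          (IsFullLattice (Π i, L i) M ∧ M / M = Λ₂) ∧ M * ((M / M) / M) = M / M},
        Quot.mk _ M = q ∧ ∃ u : (Π i, L i)ˣ, u • (Λ₁ * M.1) = Λ₁} := by
  classical
  have hE := IsCMAlgTorusRat.equivalence_exists_units_smul_eq (L := L)
    (fun M => (IsFullLattice (Π i, L i) M ∧ M / M = Λ₂) ∧ M * ((M / M) / M) = M / M)
  have hΛ₁Λ₂ : Λ₁ * Λ₂ = Λ₁ := order_mul_order_eq_of_le hΛ₁Λ₁ h2 hle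
  -- `L₂ ∈ G(Λ₂)` with `Λ₁L₂ = L₁`, and its inverse `I = L₂⁻¹`
  obtain ⟨L₂, hL₂, hO₂, hinv₂, hmul⟩ :=
    exists_invertible_order_mul_eq hΛ₁Λ₁ hΛ₂ h2 hΛ₂Λ₂ hle L₁.2.1.1 L₁.2.1.2 L₁.2.2
  let M₀ : {M : Submodule ℤ (Π i, L i) //
      (IsFullLattice (Π i, L i) M ∧ M / M = Λ₂) ∧ M * ((M / M) / M) = M / M} := ⟨L₂, ⟨hL₂, hO₂⟩, hinv₂⟩
  let I : {M : Submodule ℤ (Π i, L i) //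
      (IsFullLattice (Π i, L i) M ∧ M / M = Λ₂) ∧ M * ((M / M) / M) = M / M} :=
    ⟨(L₂ / L₂) / L₂, inv_mem_pic M₀⟩
  have hMI : L₂ * ((L₂ / L₂) / L₂) = Λ₂ := by rw [hinv₂, hO₂]
  have hmulΛ₂ : ∀ K : {M : Submodule ℤ (Π i, L i) //
      (IsFullLattice (Π i, L i) M ∧ M / M = Λ₂) ∧ M * ((M / M) / M) = M / M}, K.1 * Λ₂ = K.1 := fun K => by
    have h := div_self_mul_self K.1
    rw [K.2.1.2, mul_comm] at h
    exact h
  -- translation by `[L₂]_ε`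
  let τ : Quot (fun M M' : {M : Submodule ℤ (Π i, L i) //
          (IsFullLattice (Π i, L i) M ∧ M / M = Λ₂) ∧ M * ((M / M) / M) = M / M} =>
        ∃ u : (Π i, L i)ˣ, u • (M : Submodule ℤ (Π i, L i)) = M') →
      Quot (fun M M' : {M : Submodule ℤ (Π i, L i) //
          (IsFullLattice (Π i, L i) M ∧ M / M = Λ₂) ∧ M * ((M / M) / M) = M / M} =>
        ∃ u : (Π i, L i)ˣ, u • (M : Submodule ℤ (Π i, L i)) = M') :=
    Quot.map (fun K => ⟨K.1 * L₂, mul_mem_pic K M₀⟩) fun K K' ⟨u, hu⟩ => ⟨u, by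
      change u • (K.1 * L₂) = K'.1 * L₂
      rw [units_smul_mul, hu]⟩
  have hτ : ∀ K : {M : Submodule ℤ (Π i, L i) //
      (IsFullLattice (Π i, L i) M ∧ M / M = Λ₂) ∧ M * ((M / M) / M) = M / M},
      τ (Quot.mk _ K) = Quot.mk _ ⟨K.1 * L₂, mul_mem_pic K M₀⟩ := fun K => rfl
  -- `τ` maps the kernel into the fibre over `[L₁]_ε`
  have hinto : ∀ q, (∃ M : {M : Submodule ℤ (Π i, L i) //
        (IsFullLattice (Π i, L i) M ∧ M / M = Λ₂) ∧ M * ((M / M) / M) = M / M},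
        Quot.mk _ M = q ∧ ∃ u : (Π i, L i)ˣ, u • (Λ₁ * M.1) = Λ₁) →
      ∃ M : {M : Submodule ℤ (Π i, L i) //
        (IsFullLattice (Π i, L i) M ∧ M / M = Λ₂) ∧ M * ((M / M) / M) = M / M},
        Quot.mk _ M = τ q ∧ ∃ u : (Π i, L i)ˣ, u • (Λ₁ * M.1) = L₁.1 := by
    rintro q ⟨K, rfl, u, hu⟩
    refine ⟨⟨K.1 * L₂, mul_mem_pic K M₀⟩, (hτ K).symm, u, ?_⟩
    change u • (Λ₁ * (K.1 * L₂)) = L₁.1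
    rw [← mul_assoc, units_smul_mul, hu, hmul]
  let τ' : {q : Quot (fun M M' : {M : Submodule ℤ (Π i, L i) //
          (IsFullLattice (Π i, L i) M ∧ M / M = Λ₂) ∧ M * ((M / M) / M) = M / M} =>
        ∃ u : (Π i, L i)ˣ, u • (M : Submodule ℤ (Π i, L i)) = M') //
      ∃ M : {M : Submodule ℤ (Π i, L i) //
          (IsFullLattice (Π i, L i) M ∧ M / M = Λ₂) ∧ M * ((M / M) / M) = M / M},
        Quot.mk _ M = q ∧ ∃ u : (Π i, L i)ˣ, u • (Λ₁ * M.1) = Λ₁} →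
      {q : Quot (fun M M' : {M : Submodule ℤ (Π i, L i) //
          (IsFullLattice (Π i, L i) M ∧ M / M = Λ₂) ∧ M * ((M / M) / M) = M / M} =>
        ∃ u : (Π i, L i)ˣ, u • (M : Submodule ℤ (Π i, L i)) = M') //
      ∃ M : {M : Submodule ℤ (Π i, L i) //
          (IsFullLattice (Π i, L i) M ∧ M / M = Λ₂) ∧ M * ((M / M) / M) = M / M},
        Quot.mk _ M = q ∧ ∃ u : (Π i, L i)ˣ, u • (Λ₁ * M.1) = L₁.1} :=
    fun x => ⟨τ x.1, hinto x.1 x.2⟩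
  refine (Nat.card_congr (Equiv.ofBijective τ' ⟨fun x y hxy => ?_, fun y => ?_⟩)).symm
  · -- injective: `v(KL₂) = K'L₂` gives `vK = K'` after multiplying by `L₂⁻¹`
    obtain ⟨K, hK, -⟩ := x.2
    obtain ⟨K', hK', -⟩ := y.2
    apply Subtype.ext
    have h : τ x.1 = τ y.1 := congrArg Subtype.val hxy
    rw [← hK, ← hK', hτ, hτ] at h
    have h' := hE.eqvGen_iff.1 (Quot.eqvGen_exact h)
    obtain ⟨v, hv⟩ := h'
    change v • (K.1 * L₂) = K'.1 * L₂ at hv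
    rw [← hK, ← hK']
    refine Quot.sound ⟨v, ?_⟩
    have h2 := congrArg (· * ((L₂ / L₂) / L₂)) hv
    rwa [units_smul_mul, mul_assoc, mul_assoc, hMI, ← units_smul_mul, hmulΛ₂ K, hmulΛ₂ K'] at h2
  · -- surjective: `[M]_ε` over `[L₁]_ε` is `τ[ML₂⁻¹]_ε`, and `[ML₂⁻¹]_ε` lies in the kernel
    obtain ⟨M, hM, u, hu⟩ := y.2
    refine ⟨⟨Quot.mk _ ⟨M.1 * ((L₂ / L₂) / L₂), mul_mem_pic M I⟩, ⟨M.1 * ((L₂ / L₂) / L₂), mul_mem_pic M I⟩,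
      rfl, u, ?_⟩, ?_⟩
    · change u • (Λ₁ * (M.1 * ((L₂ / L₂) / L₂))) = Λ₁
      rw [← mul_assoc, units_smul_mul, hu, ← hmul, mul_assoc, hMI, hΛ₁Λ₂]
    · apply Subtype.ext
      change τ (Quot.mk _ _) = y.1
      rw [hτ, ← hM]
      refine Quot.sound ⟨1, ?_⟩
      change (1 : (Π i, L i)ˣ) • ((M.1 * ((L₂ / L₂) / L₂)) * L₂) = M.1
      rw [one_smul, mul_assoc, mul_comm ((L₂ / L₂) / L₂) L₂, hMI, hmulΛ₂ M]

/-- **THEOREM 8.2 (e)–(f), counting form: `#G([Λ_2]_ε) = #G([Λ_1]_ε) · #ker(G([Λ_2]_ε) → G([Λ_1]_ε))`** for orders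
`Λ_2 ⊆ Λ_1` of `Y` — (8.2) is surjective and all its fibres have the size of the kernel
`{[K]_ε | uΛ_1K = Λ_1 for some u ∈ Y^{unit}}` («The size of one of them can be calculated by the size of the other
one»; HL's (f) further identifies the kernel: `|ker| = |(Λ_1/C)^{unit}|/|(Λ_2/C)^{unit}| / [Λ_1^{unit} : Λ_2^{unit}]`,
not formalised here). [cite: HertlingLarabi2026, §8 Thm. 8.2 (e), (f) (8.10), chunks p0021–p0023]
[cite: NeukirchANT1999, I §12 Thm. (12.12) (one field: `h(𝒪)/h_K = #(𝒪_K/𝔣)^*/#(𝒪/𝔣)^* · 1/[𝒪_K^* : 𝒪^*]`), as identified by HertlingLarabi2026 Rem. 8.3] -/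
theorem natCard_quot_pic_eq_natCard_quot_pic_mul_natCard_ker {Λ₁ Λ₂ : Submodule ℤ (Π i, L i)}
    (hΛ₁ : IsFullLattice (Π i, L i) Λ₁) (h1 : (1 : Π i, L i) ∈ Λ₁) (hΛ₁Λ₁ : Λ₁ * Λ₁ ≤ Λ₁)
    (hΛ₂ : IsFullLattice (Π i, L i) Λ₂) (h2 : (1 : Π i, L i) ∈ Λ₂) (hΛ₂Λ₂ : Λ₂ * Λ₂ ≤ Λ₂) (hle : Λ₂ ≤ Λ₁) :
    Nat.card (Quot (fun M M' : {M : Submodule ℤ (Π i, L i) //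
        (IsFullLattice (Π i, L i) M ∧ M / M = Λ₂) ∧ M * ((M / M) / M) = M / M} =>
      ∃ u : (Π i, L i)ˣ, u • (M : Submodule ℤ (Π i, L i)) = M')) =
    Nat.card (Quot (fun M M' : {M : Submodule ℤ (Π i, L i) //
        (IsFullLattice (Π i, L i) M ∧ M / M = Λ₁) ∧ M * ((M / M) / M) = M / M} =>
      ∃ u : (Π i, L i)ˣ, u • (M : Submodule ℤ (Π i, L i)) = M')) *
    Nat.card {q : Quot (fun M M' : {M : Submodule ℤ (Π i, L i) //
          (IsFullLattice (Π i, L i) M ∧ M / M = Λ₂) ∧ M * ((M / M) / M) = M / M} =>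
        ∃ u : (Π i, L i)ˣ, u • (M : Submodule ℤ (Π i, L i)) = M') //
      ∃ M : {M : Submodule ℤ (Π i, L i) //
          (IsFullLattice (Π i, L i) M ∧ M / M = Λ₂) ∧ M * ((M / M) / M) = M / M},
        Quot.mk _ M = q ∧ ∃ u : (Π i, L i)ˣ, u • (Λ₁ * M.1) = Λ₁} := by
  classical
  haveI := finite_quot_pic_div_self_eq (L := L) Λ₂
  haveI := finite_quot_pic_div_self_eq (L := L) Λ₁
  letI := Fintype.ofFinite (Quot (fun M M' : {M : Submodule ℤ (Π i, L i) //
      (IsFullLattice (Π i, L i) M ∧ M / M = Λ₁) ∧ M * ((M / M) / M) = M / M} =>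
    ∃ u : (Π i, L i)ˣ, u • (M : Submodule ℤ (Π i, L i)) = M'))
  have hE₁ := IsCMAlgTorusRat.equivalence_exists_units_smul_eq (L := L)
    (fun M => (IsFullLattice (Π i, L i) M ∧ M / M = Λ₁) ∧ M * ((M / M) / M) = M / M)
  have hE₂ := IsCMAlgTorusRat.equivalence_exists_units_smul_eq (L := L)
    (fun M => (IsFullLattice (Π i, L i) M ∧ M / M = Λ₂) ∧ M * ((M / M) / M) = M / M)
  -- the map (8.2)
  let φ : Quot (fun M M' : {M : Submodule ℤ (Π i, L i) //
        (IsFullLattice (Π i, L i) M ∧ M / M = Λ₂) ∧ M * ((M / M) / M) = M / M} =>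
      ∃ u : (Π i, L i)ˣ, u • (M : Submodule ℤ (Π i, L i)) = M') →
      Quot (fun M M' : {M : Submodule ℤ (Π i, L i) //
        (IsFullLattice (Π i, L i) M ∧ M / M = Λ₁) ∧ M * ((M / M) / M) = M / M} =>
      ∃ u : (Π i, L i)ˣ, u • (M : Submodule ℤ (Π i, L i)) = M') :=
    Quot.lift (fun M => Quot.mk _ ⟨Λ₁ * M.1, order_mul_mem_pic hΛ₁ h1 hΛ₁Λ₁ h2 hle M⟩)
      fun M M' ⟨u, hu⟩ => Quot.sound ⟨u, by
        change u • (Λ₁ * M.1) = Λ₁ * M'.1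
        rw [← units_smul_order_mul, hu]⟩
  -- its fibre over `[L₁]_ε`, intrinsically
  have hfibre : ∀ (L₁ : {M : Submodule ℤ (Π i, L i) //
      (IsFullLattice (Π i, L i) M ∧ M / M = Λ₁) ∧ M * ((M / M) / M) = M / M}) (q),
      φ q = Quot.mk _ L₁ ↔ ∃ M : {M : Submodule ℤ (Π i, L i) //
          (IsFullLattice (Π i, L i) M ∧ M / M = Λ₂) ∧ M * ((M / M) / M) = M / M},
        Quot.mk _ M = q ∧ ∃ u : (Π i, L i)ˣ, u • (Λ₁ * M.1) = L₁.1 := by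
    intro L₁ q
    induction q using Quot.ind with | mk M => ?_
    change Quot.mk _ ⟨Λ₁ * M.1, _⟩ = Quot.mk _ L₁ ↔ _
    constructor
    · intro h
      have h' := hE₁.eqvGen_iff.1 (Quot.eqvGen_exact h)
      exact ⟨M, rfl, h'⟩
    · rintro ⟨M', hM', u, hu⟩
      have h' := hE₂.eqvGen_iff.1 (Quot.eqvGen_exact hM')
      obtain ⟨v, hv⟩ := h'
      refine Quot.sound ⟨u * v⁻¹, ?_⟩
      change (u * v⁻¹) • (Λ₁ * M.1) = L₁.1
      change v • M'.1 = M.1 at hv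
      rw [← hv, units_smul_order_mul, mul_smul, inv_smul_smul, hu]
  have hfib : ∀ q₁, Nat.card {q // φ q = q₁} =
      Nat.card {q : Quot (fun M M' : {M : Submodule ℤ (Π i, L i) //
            (IsFullLattice (Π i, L i) M ∧ M / M = Λ₂) ∧ M * ((M / M) / M) = M / M} =>
          ∃ u : (Π i, L i)ˣ, u • (M : Submodule ℤ (Π i, L i)) = M') //
        ∃ M : {M : Submodule ℤ (Π i, L i) //
            (IsFullLattice (Π i, L i) M ∧ M / M = Λ₂) ∧ M * ((M / M) / M) = M / M},
          Quot.mk _ M = q ∧ ∃ u : (Π i, L i)ˣ, u • (Λ₁ * M.1) = Λ₁} := fun q₁ => by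
    induction q₁ using Quot.ind with | mk L₁ => ?_
    rw [Nat.card_congr (Equiv.subtypeEquivRight (hfibre L₁)),
      natCard_fiber_quot_pic_eq hΛ₁Λ₁ hΛ₂ h2 hΛ₂Λ₂ hle L₁]
  rw [Nat.card_congr (Equiv.sigmaFiberEquiv φ).symm, Nat.card_sigma, Finset.sum_congr rfl fun q₁ _ => hfib q₁,
    Finset.sum_const, Finset.card_univ, ← Nat.card_eq_fintype_card, smul_eq_mul]

/-- **COROLLARY (8.10): `#G([Λ_1]_ε)` DIVIDES `#G([Λ_2]_ε)`** for orders `Λ_2 ⊆ Λ_1` of `Y`.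
[cite: HertlingLarabi2026, §8 Thm. 8.2 (f) (8.10), chunk p0021] -/
theorem natCard_quot_pic_dvd {Λ₁ Λ₂ : Submodule ℤ (Π i, L i)} (hΛ₁ : IsFullLattice (Π i, L i) Λ₁)
    (h1 : (1 : Π i, L i) ∈ Λ₁) (hΛ₁Λ₁ : Λ₁ * Λ₁ ≤ Λ₁) (hΛ₂ : IsFullLattice (Π i, L i) Λ₂)
    (h2 : (1 : Π i, L i) ∈ Λ₂) (hΛ₂Λ₂ : Λ₂ * Λ₂ ≤ Λ₂) (hle : Λ₂ ≤ Λ₁) :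
    Nat.card (Quot (fun M M' : {M : Submodule ℤ (Π i, L i) //
        (IsFullLattice (Π i, L i) M ∧ M / M = Λ₁) ∧ M * ((M / M) / M) = M / M} =>
      ∃ u : (Π i, L i)ˣ, u • (M : Submodule ℤ (Π i, L i)) = M')) ∣
    Nat.card (Quot (fun M M' : {M : Submodule ℤ (Π i, L i) //
        (IsFullLattice (Π i, L i) M ∧ M / M = Λ₂) ∧ M * ((M / M) / M) = M / M} =>
      ∃ u : (Π i, L i)ˣ, u • (M : Submodule ℤ (Π i, L i)) = M')) :=
  Dvd.intro _ (natCard_quot_pic_eq_natCard_quot_pic_mul_natCard_ker hΛ₁ h1 hΛ₁Λ₁ hΛ₂ h2 hΛ₂Λ₂ hle).symm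

end PicardExtension

end Literature.NumberTheory.ComplexMultiplication
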